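import Summits.KontsevichZagierPeriods.KontsevichZagierPeriods.Theses.UnfoldedStokes
import Summits.KontsevichZagierPeriods.KontsevichZagierPeriods.Theorems.PlanarAreas.Negative.WindowDefect
import Literature.Barriers.KontsevichZagierPeriods.AlgebraicPrimitivesObstruction
import Literature.NumberTheory.Transcendental.KZCubicalCalculus
import Literature.NumberTheory.Transcendental.KZCalculusProofs
import Summits.KontsevichZagierPeriods.KontsevichZagierPeriods.Theorems.LogPrimitiveNL.Negative.Defs

/-!
# `CubeKernelStep` (stmt-KontsevichZagierPeriods-17854) — negative side II: the layers need rule (2)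

cdisprove (refuter) negative lemmas for the crux `CubeKernelStep` of route
`KontsevichZagierPeriods/UnfoldedStokes` ("continuous closed-cube kernel in dimensions `≤ d` generated
`⇒` generated in dimension `d + 1`", `d ≥ 1`).

The SUB-CALCULUS WITHOUT CHANGE OF VARIABLES, `rulesOneThree = closure ((1a) ∪ (1b) ∪ (3))`, is used
as a model. Witness: the continuous closed-interval representation

  `kernelRep = [[0,1], 2t/(2 − t²) − 1/(2 − t)]`  (value `0`: it is ONE move of rule (2), `t ↦ t²`
  applied to `∫₀¹ dt/(2 − t)`; Ayoub Rem. 1.5, Fresán Rem. 3.7; tree `integral_kernelElt_eq_zero`).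

Along any chain of rules (1a), (1b), (3) — through all dimensions — the first-coordinate window values
`e ↦ Λₑ` are `ℚ`-semialgebraic up to a constant (tree: `PlanarAreas.Negative.winSemialgebraic_of_mem`);
for `kernelRep` they are the clamped transcendental primitive `log (2 − e) − log (2 − e²)`, whose
derivative `2e/(2 − e²) − 1/(2 − e)` has no `ℚ`-semialgebraic primitive (tree barrier
`algebraicPrimitivesObstructionNarrow_holds`). Hence (all sorry-free):

* `kernelRep_not_mem_rulesOneThree`, `firstLayer_false_without_changeOfVariables` — LAYER 1 of the
  continuous cube kernel (the HYPOTHESIS of the crux's first instance) is not generated without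
  rule (2); by slab lifts (one Newton–Leibniz move each) NO layer `≥ 1` is
  (`layer_succ_false_without_changeOfVariables`), while layer `0` is
  (`layer_zero_without_changeOfVariables`);
* `step_without_changeOfVariables` — nevertheless the STEP HOLDS in this sub-calculus, vacuously: a
  model of `CubeKernelStep`-shape in which every positive layer of the kernel conjecture fails (no
  invariant / sub-calculus refutes the crux without certifying the whole interval layer);
* `stepFromZero_false_without_changeOfVariables` — the crux WITHOUT its side condition `1 ≤ d` is
  FALSE in the sub-calculus (the step `0 → 1` fails): the side condition is load-bearing, and every
  proof of the interval layer runs through change of variables (functoriality), never through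
  additivity + Newton–Leibniz alone — consistent with Huber–Wüstholz (relations of 1-periods come from
  correspondences).

[Kontsevich–Zagier 2001, §1.2; Ayoub 2015, Rem. 1.2, 1.5; Fresán 2024, Rem. 3.6–3.7; Huber–Wüstholz 2022, Thm. 13.3]
-/

noncomputable section

namespace Summit.KontsevichZagierPeriods.UnfoldedStokes.CubeKernelStepNegative

open MeasureTheory Set Filter Topology
open Literature.NumberTheory.Transcendental
open Literature.NumberTheory.Transcendental.KZ
open Literature.ModelTheory.ExponentialFields (IsSemialgebraic)
open Summit.KontsevichZagierPeriods.PlanarAreas.Negative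
  (win measurableSet_win WinSemialgebraic winSemialgebraic_of_mem setIntegral_clamp)
open Literature.Barriers.KontsevichZagierPeriods.KZ (algebraicPrimitivesObstructionNarrow_holds)

/-! ### The sub-calculus without change of variables -/

/-- The subgroup generated by rules (1a), (1b), (3) — everything except change of variables.
[cite: KontsevichZagier2001, §1.2] -/
def rulesOneThree : AddSubgroup FormalRep :=
  AddSubgroup.closure (domainAddRel ∪ integrandAddRel ∪ newtonLeibnizRel)

/-- Rule (1b) lies in the sub-calculus. [folklore] -/
theorem integrandAddRel_subset_rulesOneThree : integrandAddRel ⊆ rulesOneThree :=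
  fun _ hc => AddSubgroup.subset_closure (Or.inl (Or.inr hc))

/-- Rule (3) lies in the sub-calculus. [folklore] -/
theorem newtonLeibnizRel_subset_rulesOneThree : newtonLeibnizRel ⊆ rulesOneThree :=
  fun _ hc => AddSubgroup.subset_closure (Or.inr hc)

/-! ### The witness `[[0,1], 2t/(2 − t²) − 1/(2 − t)]` -/

/-- The kernel function of one real variable `f(t) = 2t/(2 − t²) − 1/(2 − t)` (Fresán's example).
[cite: Fresan2024, Rem. 3.7] -/
def kernelFun₁ (t : ℝ) : ℝ := 2 * t / (2 - t ^ 2) - 1 / (2 - t)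

/-- The same function as an integrand on `ℝ¹`. [cite: Fresan2024, Rem. 3.7] -/
def kernelFun (x : Fin 1 → ℝ) : ℝ := kernelFun₁ (x 0)

/-- `2 − t² > 0` on `[0,1]`. [folklore] -/
theorem two_sub_sq_pos {t : ℝ} (ht : t ∈ Icc (0:ℝ) 1) : 0 < 2 - t ^ 2 := by nlinarith [ht.1, ht.2]
/-- `2 − t > 0` on `[0,1]`. [folklore] -/
theorem two_sub_pos {t : ℝ} (ht : t ∈ Icc (0:ℝ) 1) : 0 < 2 - t := by linarith [ht.2]

/-- A point of the closed unit interval `[0,1] ⊆ ℝ¹` has its coordinate in `[0,1]`. [folklore] -/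
theorem apply_mem_Icc_of_mem_cube {x : Fin 1 → ℝ} (hx : x ∈ cube 1) : x 0 ∈ Icc (0:ℝ) 1 :=
  ⟨(hx 0).1, (hx 0).2⟩

/-- The coordinate `x ↦ x 0` is analytic. [folklore] -/
theorem analyticAt_apply_zero (x : Fin 1 → ℝ) : AnalyticAt ℝ (fun y : Fin 1 → ℝ => y 0) x :=
  (ContinuousLinearMap.proj (R := ℝ) (φ := fun _ : Fin 1 => ℝ) 0).analyticAt x

/-- The kernel function is analytic near the closed unit interval (poles at `2`, `±√2`). [folklore] -/
theorem kernelFun_analyticOnNhd : AnalyticOnNhd ℝ kernelFun (cube 1) := by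
  intro x hx
  have h0 := apply_mem_Icc_of_mem_cube hx
  have hp := analyticAt_apply_zero x
  have hA : AnalyticAt ℝ (fun y : Fin 1 → ℝ => 2 * y 0 / (2 - y 0 ^ 2)) x :=
    (analyticAt_const.mul hp).div (analyticAt_const.sub (hp.pow 2)) (two_sub_sq_pos h0).ne'
  have hB : AnalyticAt ℝ (fun y : Fin 1 → ℝ => 1 / (2 - y 0)) x :=
    analyticAt_const.div (analyticAt_const.sub hp) (two_sub_pos h0).ne'
  exact hA.sub hB

/-- The kernel function is `ℚ`-semialgebraic on the interval (a quotient of `ℚ`-polynomials with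
non-vanishing denominator). [cite: KontsevichZagier2001, §1.1] -/
theorem kernelFun_isSemialgebraicFunOn : IsSemialgebraicFunOn ℚ (cube 1) kernelFun := by
  have hq : ∀ x ∈ cube 1, MvPolynomial.aeval x
      ((MvPolynomial.C 2 - MvPolynomial.X 0 ^ 2) * (MvPolynomial.C 2 - MvPolynomial.X 0) :
        MvPolynomial (Fin 1) ℚ) ≠ 0 := by
    intro x hx
    have h0 := apply_mem_Icc_of_mem_cube hx
    have h1 := (two_sub_sq_pos h0).ne'
    have h2 := (two_sub_pos h0).ne'
    simp only [map_mul, map_sub, map_pow, MvPolynomial.aeval_C, MvPolynomial.aeval_X, eq_ratCast,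
      Rat.cast_ofNat]
    exact mul_ne_zero h1 h2
  refine (isSemialgebraicFunOn_aeval_div_aeval (k := ℚ) (R := ℝ) isSemialgebraic_cube
    (MvPolynomial.C 2 * MvPolynomial.X 0 * (MvPolynomial.C 2 - MvPolynomial.X 0) -
      (MvPolynomial.C 2 - MvPolynomial.X 0 ^ 2) : MvPolynomial (Fin 1) ℚ)
    ((MvPolynomial.C 2 - MvPolynomial.X 0 ^ 2) * (MvPolynomial.C 2 - MvPolynomial.X 0)) hq).congr ?_
  intro x hx
  have h0 := apply_mem_Icc_of_mem_cube hx
  have h1 := (two_sub_sq_pos h0).ne'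
  have h2 := (two_sub_pos h0).ne'
  simp only [map_mul, map_sub, map_pow, MvPolynomial.aeval_C, MvPolynomial.aeval_X, eq_ratCast,
    Rat.cast_ofNat, kernelFun, kernelFun₁]
  rw [div_sub_div _ _ h1 h2]
  ring

/-- **The witness** `kernelRep = [[0,1], 2t/(2 − t²) − 1/(2 − t)]`: a continuous closed-interval
representation of KZ's literal shape. [cite: Fresan2024, Rem. 3.7] -/
def kernelRep : IntegralRep 1 :=
  IntegralRep.tameCube kernelFun kernelFun_analyticOnNhd kernelFun_isSemialgebraicFunOn

/-- The domain of the witness, in the product form of the crux. [folklore] -/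
theorem kernelRep_domain : kernelRep.domain = Set.pi Set.univ (fun _ : Fin 1 => Set.Icc (0:ℝ) 1) :=
  cube_eq_pi 1

/-- The domain of the witness is the closed unit interval. [folklore] -/
theorem kernelRep_domain_eq_cube : kernelRep.domain = cube 1 := rfl
/-- The integrand of the witness. [folklore] -/
theorem kernelRep_integrand : kernelRep.integrand = kernelFun := rfl

/-- The integrand of the witness is continuous on the CLOSED interval. [folklore] -/
theorem kernelRep_continuousOn : ContinuousOn kernelRep.integrand kernelRep.domain :=
  kernelFun_analyticOnNhd.continuousOn

/-- The transcendental primitive `F₀(t) = log (2 − t) − log (2 − t²)`. [cite: Fresan2024, Rem. 3.6] -/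
def F₀ (t : ℝ) : ℝ := Real.log (2 - t) - Real.log (2 - t * t)

/-- `F₀' = f` on `[0,1]`. [folklore] -/
theorem hasDerivAt_F₀ {t : ℝ} (ht : t ∈ Icc (0:ℝ) 1) : HasDerivAt F₀ (kernelFun₁ t) t := by
  have h2 : (2 : ℝ) - t ≠ 0 := (two_sub_pos ht).ne'
  have h1' : (2 : ℝ) - t ^ 2 ≠ 0 := (two_sub_sq_pos ht).ne'
  have h1 : (2 : ℝ) - t * t ≠ 0 := by rw [← pow_two]; exact h1'
  have hA : HasDerivAt (fun y : ℝ => Real.log (2 - y)) ((-1) / (2 - t)) t :=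
    ((hasDerivAt_id t).const_sub 2).log h2
  have hB : HasDerivAt (fun y : ℝ => Real.log (2 - y * y)) ((-(1 * t + t * 1)) / (2 - t * t)) t :=
    (((hasDerivAt_id t).mul (hasDerivAt_id t)).const_sub 2).log h1
  refine (hA.sub hB).congr_deriv ?_
  unfold kernelFun₁
  field_simp
  ring

/-- `F₀` is continuous on `[0,1]`. [folklore] -/
theorem continuousOn_F₀ : ContinuousOn F₀ (Icc 0 1) :=
  fun _ ht => (hasDerivAt_F₀ ht).continuousAt.continuousWithinAt

/-- `F₀ 0 = 0`. [folklore] -/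
@[simp] theorem F₀_zero : F₀ 0 = 0 := by simp [F₀]
/-- `F₀ 1 = 0` (so `∫₀¹ f = 0`). [folklore] -/
@[simp] theorem F₀_one : F₀ 1 = 0 := by norm_num [F₀]

/-- `f` is continuous on `[0,1]`. [folklore] -/
theorem continuousOn_kernelFun₁ : ContinuousOn kernelFun₁ (Icc 0 1) := by
  refine ContinuousOn.sub ?_ ?_
  · exact (continuousOn_const.mul continuousOn_id).div (continuousOn_const.sub (continuousOn_id.pow 2))
      fun t ht => (two_sub_sq_pos ht).ne'
  · exact continuousOn_const.div (continuousOn_const.sub continuousOn_id) fun t ht => (two_sub_pos ht).ne'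

/-- `f` is integrable on `[0,1]`. [folklore] -/
theorem integrableOn_kernelFun₁ : IntegrableOn kernelFun₁ (Icc 0 1) :=
  continuousOn_kernelFun₁.integrableOn_compact isCompact_Icc

/-- **Window values of the witness**: `Λₑ [kernelRep] = F₀ (clamp e) − F₀ 0`, the clamped
transcendental primitive. [folklore] -/
theorem restrictedEval_win_kernelRep (e : ℝ) :
    restrictedEval (win e) (of kernelRep) = F₀ (max 0 (min e 1)) - F₀ 0 := by
  rw [restrictedEval_of, kernelRep_domain_eq_cube, kernelRep_integrand]
  set E := MeasurableEquiv.funUnique (Fin 1) ℝ with hE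
  have hE_apply : ∀ z : Fin 1 → ℝ, E z = z 0 := fun z => rfl
  have hmp : MeasurePreserving E volume volume := volume_preserving_funUnique (Fin 1) ℝ
  have hset : cube 1 ∩ win e 1 = E ⁻¹' {t | 0 ≤ t ∧ t ≤ 1 ∧ t < e} := by
    ext x
    simp only [mem_inter_iff, mem_cube, Fin.forall_fin_one, mem_preimage, mem_setOf_eq, hE_apply,
      and_assoc]
    exact Iff.rfl
  rw [hset]
  change ∫ x in E ⁻¹' {t | 0 ≤ t ∧ t ≤ 1 ∧ t < e}, kernelFun₁ (E x) = _
  rw [hmp.setIntegral_preimage_emb E.measurableEmbedding kernelFun₁ {t | 0 ≤ t ∧ t ≤ 1 ∧ t < e}]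
  exact setIntegral_clamp zero_le_one continuousOn_F₀ (fun t ht => hasDerivAt_F₀ (Ioo_subset_Icc_self ht))
    integrableOn_kernelFun₁ e

/-- **The witness is a kernel element**: `∫₀¹ (2t/(2 − t²) − 1/(2 − t)) dt = 0`. [cite: Fresan2024, Rem. 3.7] -/
theorem value_kernelRep : kernelRep.value = 0 := by
  have h := restrictedEval_win_kernelRep 2
  have hset : kernelRep.domain ∩ win 2 1 = kernelRep.domain := inter_eq_left.mpr fun x hx => by
    rw [kernelRep_domain_eq_cube] at hx
    show x 0 < 2
    linarith [(hx 0).2]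
  rw [restrictedEval_of, hset] at h
  rw [IntegralRep.value, h]
  norm_num

/-- **THE SEPARATION.** `[kernelRep]` is not in the subgroup generated by rules (1a), (1b), (3):
along such chains the window values are `ℚ`-semialgebraic up to a constant
(`winSemialgebraic_of_mem`), here they are `log (2 − e) − log (2 − e²)` on `(0,1)`, and
`2e/(2 − e²) − 1/(2 − e)` has no `ℚ`-semialgebraic primitive (`algebraicPrimitivesObstructionNarrow_holds`).
[cite: Ayoub2015, Rem. 1.2] [cite: Fresan2024, Rem. 3.6] -/
theorem kernelRep_not_mem_rulesOneThree : of kernelRep ∉ rulesOneThree := by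
  intro hmem
  obtain ⟨Φ, C, hΦ, hwin⟩ := winSemialgebraic_of_mem hmem
  have hformula : ∀ s ∈ Ioo (0:ℝ) 1, Φ s = F₀ s - C := by
    intro s hs
    have h := hwin s
    rw [restrictedEval_win_kernelRep, min_eq_left hs.2.le, max_eq_right hs.1.le, F₀_zero,
      sub_zero] at h
    linarith
  have hI : IsSemialgebraic ℚ {x : Fin 1 → ℝ | x 0 ∈ Icc (0:ℝ) 1} := by
    convert (isSemialgebraic_cube (n := 1)) using 1
    ext x
    simp [mem_cube, Fin.forall_fin_one]
  refine algebraicPrimitivesObstructionNarrow_holds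
    ⟨0, fun z => Φ (z 0), hΦ.mono (subset_univ _) hI, fun t ht => ?_⟩
  have hEq : (fun s : ℝ => Φ ((fun _ : Fin 1 => s) 0)) =ᶠ[𝓝 t] fun s => F₀ s - C := by
    filter_upwards [Ioo_mem_nhds ht.1 ht.2] with s hs
    exact hformula s hs
  refine HasDerivAt.congr_of_eventuallyEq ?_ hEq
  refine ((hasDerivAt_F₀ (Ioo_subset_Icc_self ht)).sub_const C).congr_deriv ?_
  simp [kernelFun₁]

/-- **LAYER 1 NEEDS RULE (2).** The interval layer of the continuous closed-cube kernel — the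
hypothesis of the first instance `d = 1` of the crux — is not generated by additivity and
Newton–Leibniz (through any dimensions). [cite: Ayoub2015, Rem. 1.2] -/
theorem firstLayer_false_without_changeOfVariables :
    ¬ ∀ t : IntegralRep 1, t.domain = Set.pi Set.univ (fun _ : Fin 1 => Set.Icc (0:ℝ) 1) →
        ContinuousOn t.integrand t.domain → t.value = 0 → of t ∈ rulesOneThree := fun h =>
  kernelRep_not_mem_rulesOneThree (h kernelRep kernelRep_domain kernelRep_continuousOn value_kernelRep)

/-! ### Every positive layer needs rule (2): slab lifts of the witness -/

/-- Slab lifts of the witness: `liftRep m = [[0,1]^{m+1}, f(x₀)]`, each obtained from the previous one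
by ONE Newton–Leibniz move (`KZ.IntegralRep.slab`). [cite: KontsevichZagier2001, §1.2 rule (3)] -/
def liftRep : (m : ℕ) → IntegralRep (m + 1)
  | 0 => kernelRep
  | m + 1 => (liftRep m).slab 0

/-- The lifts live on closed unit cubes. [folklore] -/
theorem liftRep_domain : ∀ m : ℕ,
    (liftRep m).domain = Set.pi Set.univ (fun _ : Fin (m + 1) => Set.Icc (0:ℝ) 1)
  | 0 => kernelRep_domain
  | m + 1 => by
    have ht := liftRep_domain m
    show ((liftRep m).slab 0).domain = _
    ext z
    simp only [IntegralRep.domain_slab, IntegralRep.slabDomain, ht, Nat.cast_zero, zero_add,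
      mem_setOf_eq, Set.mem_pi, mem_univ, true_implies, mem_Icc]
    constructor
    · rintro ⟨h1, h2, h3⟩ i
      refine Fin.lastCases ?_ (fun j => ?_) i
      · exact ⟨h2, h3⟩
      · simpa [Fin.init] using h1 j
    · intro hz
      exact ⟨fun j => by simpa [Fin.init] using hz (Fin.castSucc j), (hz (Fin.last (m + 1))).1,
        (hz (Fin.last (m + 1))).2⟩

/-- The lifts have integrands continuous on the closed cube. [folklore] -/
theorem liftRep_continuousOn : ∀ m : ℕ, ContinuousOn (liftRep m).integrand (liftRep m).domain
  | 0 => kernelRep_continuousOn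
  | m + 1 => by
    show ContinuousOn (fun z : Fin (m + 1 + 1) → ℝ => (liftRep m).integrand (Fin.init z))
      ((liftRep m).slabDomain 0)
    have hinit : Continuous (Fin.init : (Fin (m + 1 + 1) → ℝ) → Fin (m + 1) → ℝ) :=
      continuous_pi fun i => continuous_apply _
    exact (liftRep_continuousOn m).comp hinit.continuousOn fun z hz => hz.1

/-- Consecutive lifts differ by one Newton–Leibniz move. [cite: KontsevichZagier2001, §1.2 rule (3)] -/
theorem liftRep_succ_sub_mem (m : ℕ) : of (liftRep (m + 1)) - of (liftRep m) ∈ newtonLeibnizRel :=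
  (liftRep m).of_slab_sub_of_mem_newtonLeibnizRel 0

/-- The lifts are kernel elements. [folklore] -/
theorem value_liftRep : ∀ m : ℕ, (liftRep m).value = 0
  | 0 => value_kernelRep
  | m + 1 => by
    have h := eval_eq_zero_of_mem_newtonLeibnizRel_holds (liftRep_succ_sub_mem m)
    rw [map_sub, eval_of, eval_of, value_liftRep m, sub_zero] at h
    exact h

/-- A lift is generated without rule (2) iff the witness is. [folklore] -/
theorem liftRep_mem_iff : ∀ m : ℕ, of (liftRep m) ∈ rulesOneThree ↔ of kernelRep ∈ rulesOneThree
  | 0 => Iff.rfl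
  | m + 1 => by
    rw [← liftRep_mem_iff m]
    have h := newtonLeibnizRel_subset_rulesOneThree (liftRep_succ_sub_mem m)
    constructor
    · intro h1
      simpa using rulesOneThree.sub_mem h1 h
    · intro h0
      simpa using rulesOneThree.add_mem h h0

/-- **NO POSITIVE LAYER IS GENERATED WITHOUT RULE (2).** [cite: Ayoub2015, Rem. 1.2] -/
theorem layer_succ_false_without_changeOfVariables (m : ℕ) :
    ¬ ∀ t : IntegralRep (m + 1), t.domain = Set.pi Set.univ (fun _ : Fin (m + 1) => Set.Icc (0:ℝ) 1) →
        ContinuousOn t.integrand t.domain → t.value = 0 → of t ∈ rulesOneThree := fun h =>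
  kernelRep_not_mem_rulesOneThree ((liftRep_mem_iff m).mp
    (h (liftRep m) (liftRep_domain m) (liftRep_continuousOn m) (value_liftRep m)))

/-! ### Layer 0 holds without rule (2); the step holds vacuously; the step from zero fails -/

/-- **Layer 0 holds without rule (2)**: a point representation of value `0` has integrand `0`, and
`[r] − [r] − [r]` is then a move of rule (1b). [cite: KontsevichZagier2001, §1.2 rule (1)] -/
theorem layer_zero_without_changeOfVariables :
    ∀ t : IntegralRep 0, t.domain = Set.pi Set.univ (fun _ : Fin 0 => Set.Icc (0:ℝ) 1) →
      ContinuousOn t.integrand t.domain → t.value = 0 → of t ∈ rulesOneThree := by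
  intro t ht _ hv
  have huniv : t.domain = univ := by
    rw [ht]
    exact eq_univ_of_forall fun _ => by simp
  have hval : t.value = t.integrand (fun i => i.elim0) := by
    rw [IntegralRep.value, huniv]
    exact Summit.KontsevichZagierPeriods.LiouvilleUnfolding.LogPrimitiveNL.Negative.setIntegral_univ_fin_zero _
  have h0 : ∀ x ∈ t.domain, t.integrand x = 0 := fun x _ => by
    rw [Subsingleton.elim x (fun i => i.elim0), ← hval, hv]
  have hmem : of t - of t - of t ∈ integrandAddRel :=
    ⟨0, t, t, t, rfl, rfl, fun x hx => by simp [h0 x hx], rfl⟩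
  have h1 : -of t ∈ rulesOneThree := by simpa using integrandAddRel_subset_rulesOneThree hmem
  simpa using rulesOneThree.neg_mem h1

/-- **A MODEL OF THE STEP IN WHICH THE KERNEL CONJECTURE FAILS.** In the sub-calculus without rule (2)
the statement of `CubeKernelStep` (with `relations` replaced by `rulesOneThree`) HOLDS — vacuously,
its hypothesis failing at `M = 1 ≤ d` — although every positive layer fails there. The crux is thus
consistent with the failure of all positive layers; its content is entirely relative to the interval
layer. [cite: Ayoub2015, Rem. 1.2] -/
theorem step_without_changeOfVariables :
    ∀ d : ℕ, 1 ≤ d →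
      (∀ M : ℕ, M ≤ d → ∀ t : IntegralRep M,
        t.domain = Set.pi Set.univ (fun _ : Fin M => Set.Icc (0:ℝ) 1) →
          ContinuousOn t.integrand t.domain → t.value = 0 → of t ∈ rulesOneThree) →
      ∀ t : IntegralRep (d + 1), t.domain = Set.pi Set.univ (fun _ : Fin (d + 1) => Set.Icc (0:ℝ) 1) →
        ContinuousOn t.integrand t.domain → t.value = 0 → of t ∈ rulesOneThree :=
  fun _ hd hyp => absurd (hyp 1 hd) (layer_succ_false_without_changeOfVariables 0)

/-- **THE SIDE CONDITION `1 ≤ d` IS LOAD-BEARING (sub-calculus form).** The step FROM ZERO —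
`CubeKernelStep` with `1 ≤ d` deleted — fails without rule (2): layer `0` holds there, layer `1` does
not. In the full calculus the same deletion yields "all layers" (open, summit-implied;
`Negative/Calibration.lean`); so the mechanism proving the interval layer must be change of variables
(functoriality), and the crux proper only starts above it. [cite: Ayoub2015, Rem. 1.2]
[cite: HuberWustholz2022, Thm. 13.3] -/
theorem stepFromZero_false_without_changeOfVariables :
    ¬ ∀ d : ℕ,
      (∀ M : ℕ, M ≤ d → ∀ t : IntegralRep M,
        t.domain = Set.pi Set.univ (fun _ : Fin M => Set.Icc (0:ℝ) 1) →
          ContinuousOn t.integrand t.domain → t.value = 0 → of t ∈ rulesOneThree) →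
      ∀ t : IntegralRep (d + 1), t.domain = Set.pi Set.univ (fun _ : Fin (d + 1) => Set.Icc (0:ℝ) 1) →
        ContinuousOn t.integrand t.domain → t.value = 0 → of t ∈ rulesOneThree := by
  intro h
  refine layer_succ_false_without_changeOfVariables 0 (h 0 fun M hM => ?_)
  obtain rfl : M = 0 := Nat.le_zero.mp hM
  exact layer_zero_without_changeOfVariables

end Summit.KontsevichZagierPeriods.UnfoldedStokes.CubeKernelStepNegative

end
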